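/-
COR-CM (cell pub-hodgecm2, stage 2 of the Hodge ladder) — count-neutral KERNEL COMBINATORICS «abelian CM fields with an imaginary quadratic subfield»
(seat prover-pub-hodgecm2-b23-g39-0, binder prover b23, gen 39; claim ABELIAN-DATUM D8, HOME/INBOX.md; blanket `CorCM/FaceAbelian*`).  Theorems
only: D1 (datum), D4 (exactness), D6 (dictionary) of this lane assembled into presentation-free statements; no geometry, no named fact, nothing
asserted; `Interfaces.lean` (C1), every E term, B01 and `Transposition/*` are untouched.
HONEST FRAMING (COORDINATOR RULING — HODGE FRAMING CORRECTION, 2026-08-21T11:55:35Z): `HC_CM` is NOT proved, here or anywhere in the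
tree; this file counts faces and its one `HodgeConjectureFor` statement is CONDITIONAL on face periods; no period is produced.
T5: n/a-class — the HC-level statement displays INT2-GEN's period hypothesis only; the other binders are commutativity of `Aut(F)` and an
imaginary quadratic subfield (data); checker: self (prover-pub-hodgecm2-b23-g39-0), 2026-08-23.
-/
import Summits.HodgeConjecture.CorCM.FaceAbelianExact
import Summits.HodgeConjecture.CorCM.FaceAbelianImaginaryQuadratic
import HarnessLib

/-!
# Abelian Galois CM fields containing an imaginary quadratic field: EXACTLY `β − 1` (half-degree odd) / `β − 2` (half-degree even) faces

The presentation-free capstone of the ABELIAN-DATUM lane.  `F` a Galois CM field with COMMUTATIVE `Aut(F)` containing an IMAGINARY QUADRATIC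
subfield `E` (a subfield of degree `2` over `ℚ` with an element of non-real image under the base embedding `σ₀`; equivalently `F = E·F⁺`;
equivalently — D6 — complex conjugation is not a square in `Aut(F)`).  Write `2n = [F:ℚ]` and `β(F) = #Block conjT` for the number of blocks of
abstract CM types of `GalT F` (↔ the simple CM isogeny classes split by `F`).  Then for every base embedding `σ₀` the least number of rank-four
faces of `F` whose Weil characters at all base embeddings generate those of every face (the INT2-GEN binder `hgen(𝒮, σ₀)`) is

* **`β(F) − 1`** if `n` is odd (`n ≥ 3`) — `isLeast_card_faces_hgen_of_imaginary_quadratic_subfield_odd`;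
* **`β(F) − 2`** if `n` is even (`n ≥ 4`) — `isLeast_card_faces_hgen_of_imaginary_quadratic_subfield_even`.

(For comparison, the cyclic case `CorCM/FaceCyclicGeneration.lean`: `β(F) − 1` in both parities; the cyclic fields of degree `≡ 0 (mod 4)` have NO
imaginary quadratic subfield.)  Proof: D6 `not_isSquare_conjAut_of_imaginary_quadratic_subfield` ⟹ D1's detecting character and the canonical
presentation `Aut(F) → Aut(F)/⟨c⟩` ⟹ the datum (`exists_datum_of_presentation`, `autDatum`) ⟹ D4's exactness in the block currency.  The HC
reading (`hodgeConjectureFor_of_imaginary_quadratic_subfield_of_exists_facePeriod`): a face set of that least size EXISTS whose periods on the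
universe of record give the Hodge conjecture for every abelian variety dominated by a product of CM abelian varieties with CM by subfields of
`F` — CONDITIONAL; `HC_CM` is NOT proved, no period is produced.

References: [cite: Pohlmann1968, Thm. 1]; [cite: Milne1999LefschetzClasses, Thm. 3.2, Prop. 2.1]; [cite: Shimura1998, §6.2 Theorem 3 and §6.1
Corollary of Theorem 2 (pp. 41–43), §8.1 (p. 62)]; [cite: MumfordAV1970, §19 Thm. 1 and p. 169].
-/

noncomputable section

open CategoryTheory NumberField NumberField.ComplexEmbedding
open Literature.AlgebraicGeometry Literature.AlgebraicGeometry.Motives Literature.AlgebraicGeometry.HodgeTheory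
open Literature.AlgebraicGeometry.ComplexMultiplication Literature.AlgebraicGeometry.Milne1999
open Literature.NumberTheory.Automorphic
open Literature.NumberTheory.Automorphic.PicardCM
open Summit.HodgeConjecture.CorCM.Domination

namespace Summit.HodgeConjecture.CorCM.FaceAbelian

open Summit.HodgeConjecture.CorCM.Prior.AllgGroup.RfwfAllgGroup
open Summit.HodgeConjecture.CorCM.Census.BlockParity
open Summit.HodgeConjecture.CorCM.FaceCensus.OddSlice

variable {F : Type} [Field F] [NumberField F]

/-- **The datum of an abelian Galois field from an imaginary quadratic subfield, onto the canonical quotient.**  Commutative `Aut(F)`,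
`E ⊆ F` quadratic with a non-real element under `σ₀`, `c` the conjugation automorphism at `σ₀`: a GalT-datum
`θ : GalT F ≃ ℤ/2 × (Aut(F)/⟨c⟩)` (multiplicative-to-additive, `θ conjT = (1,0)`) onto a group of order `[F:ℚ]/2`. [folklore] -/
theorem exists_galTDatum_of_imaginary_quadratic_subfield [IsGalois ℚ F] (hcomm : ∀ g h : F ≃ₐ[ℚ] F, g * h = h * g) (σ₀ : F →+* ℂ)
    (E : IntermediateField ℚ F) (hE : Module.finrank ℚ E = 2) (hx : ∃ x ∈ E, (σ₀ x).im ≠ 0) :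
    ∃ (A : Type) (_ : AddCommGroup A) (_ : Fintype A) (θ : GalT F ≃ ZMod 2 × A),
      (∀ P Q : GalT F, θ (P * Q) = θ P + θ Q) ∧ θ conjT = (1, 0) ∧ Module.finrank ℚ F = 2 * Fintype.card A := by
  classical
  obtain ⟨c, hcσ⟩ := FaceCensus.exists_conjAut σ₀
  have hns : ¬ IsSquare c := not_isSquare_conjAut_of_imaginary_quadratic_subfield σ₀ hcσ E hE hx
  letI : CommGroup (F ≃ₐ[ℚ] F) := { (inferInstance : Group (F ≃ₐ[ℚ] F)) with mul_comm := hcomm }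
  have hc1 : c ≠ 1 := by rintro rfl; exact hns ⟨1, (mul_one 1).symm⟩
  obtain ⟨χ, hχ⟩ := exists_addChar_of_not_isSquare (G := F ≃ₐ[ℚ] F) hns
  obtain ⟨hπ, hπc, hker, hsurj⟩ := presentation_quotient c (FaceCensus.conjAut_mul_self σ₀ hcσ)
  obtain ⟨ε, hε, hεc⟩ := exists_datum_of_presentation c (fun g => χ (Additive.ofMul g)) (fun g h => by rw [ofMul_mul, map_add]) hχ
    _ hπ hπc hker hsurj
  obtain ⟨hθ, hc⟩ := autDatum σ₀ ε hε hcσ hεc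
  refine ⟨Additive ((F ≃ₐ[ℚ] F) ⧸ Subgroup.zpowers c), inferInstance, Fintype.ofFinite _, (galTOfAut σ₀).symm.trans ε, hθ, hc, ?_⟩
  have h2 := card_quotient_zpowers_mul_two (G := F ≃ₐ[ℚ] F) (FaceCensus.conjAut_mul_self σ₀ hcσ) hc1
  rw [IsGalois.card_aut_eq_finrank] at h2
  rw [← h2, Fintype.card_eq_nat_card, mul_comm]
  rfl

/-- **ABELIAN CM FIELD ⊇ IMAGINARY QUADRATIC, HALF-DEGREE ODD: EXACTLY `β(F) − 1` GENERATING FACES, NONE FEWER.**  `F` Galois CM with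
commutative `Aut(F)`, `[F:ℚ] = 2n` with `n` odd `≥ 3`, `E ⊆ F` a quadratic subfield with a non-real element under `σ₀`: the least size of a face
set `𝒮` with `hgen(𝒮, σ₀)` is `#Block conjT − 1`. [cite: Pohlmann1968, Thm. 1] [cite: Milne1999LefschetzClasses, Thm. 3.2, Prop. 2.1] -/
theorem isLeast_card_faces_hgen_of_imaginary_quadratic_subfield_odd [IsCMField F] [IsGalois ℚ F]
    (hcomm : ∀ g h : F ≃ₐ[ℚ] F, g * h = h * g) (σ₀ : F →+* ℂ) (E : IntermediateField ℚ F) (hE : Module.finrank ℚ E = 2)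
    (hx : ∃ x ∈ E, (σ₀ x).im ≠ 0) (hodd : Odd (Module.finrank ℚ F / 2)) (h6 : 6 ≤ Module.finrank ℚ F) :
    IsLeast {m : ℕ | ∃ 𝒮 : Finset (Face F), 𝒮.card = m ∧
      ∀ f : Face F, lefChar f.corner (fun _ => ({σ₀} : Finset (F →+* ℂ))) ∈ AddSubgroup.closure
        {a : Asym F | ∃ g ∈ (𝒮 : Set (Face F)), ∃ σ : F →+* ℂ, a = lefChar g.corner (fun _ => ({σ} : Finset (F →+* ℂ)))}}
      (Fintype.card (Block (conjT : GalT F)) - 1) := by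
  classical
  obtain ⟨A, _, _, θ, hθ, hc, hcard⟩ := exists_galTDatum_of_imaginary_quadratic_subfield hcomm σ₀ E hE hx
  have hA : Odd (Fintype.card A) := by rw [hcard, Nat.mul_div_cancel_left _ (by norm_num : 0 < 2)] at hodd; exact hodd
  have h3 : 3 ≤ Fintype.card A := by omega
  exact isLeast_card_faces_hgen_of_datum_odd' hA h3 θ hθ hc σ₀

/-- **ABELIAN CM FIELD ⊇ IMAGINARY QUADRATIC, HALF-DEGREE EVEN: EXACTLY `β(F) − 2` GENERATING FACES, NONE FEWER.**  `F` Galois CM with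
commutative `Aut(F)`, `[F:ℚ] = 2n` with `n` even `≥ 4`, `E ⊆ F` a quadratic subfield with a non-real element under `σ₀`: the least size of a face
set `𝒮` with `hgen(𝒮, σ₀)` is `#Block conjT − 2`. [cite: Pohlmann1968, Thm. 1] [cite: Milne1999LefschetzClasses, Thm. 3.2, Prop. 2.1] -/
theorem isLeast_card_faces_hgen_of_imaginary_quadratic_subfield_even [IsCMField F] [IsGalois ℚ F]
    (hcomm : ∀ g h : F ≃ₐ[ℚ] F, g * h = h * g) (σ₀ : F →+* ℂ) (E : IntermediateField ℚ F) (hE : Module.finrank ℚ E = 2)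
    (hx : ∃ x ∈ E, (σ₀ x).im ≠ 0) (heven : Even (Module.finrank ℚ F / 2)) (h8 : 8 ≤ Module.finrank ℚ F) :
    IsLeast {m : ℕ | ∃ 𝒮 : Finset (Face F), 𝒮.card = m ∧
      ∀ f : Face F, lefChar f.corner (fun _ => ({σ₀} : Finset (F →+* ℂ))) ∈ AddSubgroup.closure
        {a : Asym F | ∃ g ∈ (𝒮 : Set (Face F)), ∃ σ : F →+* ℂ, a = lefChar g.corner (fun _ => ({σ} : Finset (F →+* ℂ)))}}
      (Fintype.card (Block (conjT : GalT F)) - 2) := by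
  classical
  obtain ⟨A, _, _, θ, hθ, hc, hcard⟩ := exists_galTDatum_of_imaginary_quadratic_subfield hcomm σ₀ E hE hx
  have hA : Even (Fintype.card A) := by rw [hcard, Nat.mul_div_cancel_left _ (by norm_num : 0 < 2)] at heven; exact heven
  have h4 : 4 ≤ Fintype.card A := by omega
  exact isLeast_card_faces_hgen_of_datum_even' hA h4 θ hθ hc σ₀

/-- **HC reading** (INT2-GEN socket BY NAME; CONDITIONAL on the periods — `HC_CM` is NOT proved): `K` Galois CM with commutative `Aut(K)`
containing an imaginary quadratic subfield, `[K:ℚ] ≥ 6`: there is a face set `𝒮` of the least size (`β − 1` for half-degree odd, `β − 2` for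
half-degree even `≥ 4`) such that ONE period witness per face of `𝒮` on the universe of record implies the Hodge conjecture for every abelian
variety dominated by a product of CM abelian varieties with CM by subfields of `K`.
[cite: Shimura1998, §6.2 Theorem 3 and §6.1 Corollary of Theorem 2 (pp. 41–43)] [cite: Pohlmann1968, Thm. 1]
[cite: Milne1999LefschetzClasses, Thm. 3.2 and Cor. 4.5] [cite: MumfordAV1970, §19 Thm. 1 and p. 169] -/
theorem hodgeConjectureFor_of_imaginary_quadratic_subfield_of_exists_facePeriod (K : CMField) [hGal : IsGalois ℚ K]
    (hcomm : ∀ g h : ((K : Type) ≃ₐ[ℚ] (K : Type)), g * h = h * g) (σ₀ : (K : Type) →+* ℂ)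
    (E : IntermediateField ℚ (K : Type)) (hE : Module.finrank ℚ E = 2) (hx : ∃ x ∈ E, (σ₀ x).im ≠ 0) (h6 : 6 ≤ Module.finrank ℚ K) :
    ∃ 𝒮 : Finset (Face K),
      𝒮.card = Fintype.card (Block (conjT : GalT K)) - (if Even (Module.finrank ℚ K / 2) then 2 else 1) ∧
      ((∀ f ∈ 𝒮, ∃ ι₁ : K →+* ℂ, f.Admissible ι₁ ∧ ∃ (V : HermSpace3 K ι₁) (σ : K →+* ℂ),
        (Model.picardCMUniverse exists_isReal_hodgeModel_holds hodgePQ_independent_of_hodgeModel_holds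
          BallQuotient.ballQuotientUniformised_holds cmAbelianVarietyRealised_holds).PeriodNV ι₁ V K f.psi σ) →
      ∀ {P B : AbelianVariety ℂ}, AbelianVariety.IsProductOf (fun B : AbelianVariety ℂ =>
        ∃ (E : Type) (_ : Field E) (_ : NumberField E) (_ : IsCMField E) (_ : E →+* (K : Type)) (Φ : CMType E)
          (ι : 𝓞 E →+* End B) (θ : E →+* Module.End ℂ (complexBetti B.X 1)),
          IsCMTypeRealisation Φ B ι θ) P →
      AVDominatedBy B P → HodgeConjectureFor B.dim B.X) := by
  classical
  by_cases hpar : Even (Module.finrank ℚ (K : Type) / 2)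
  · -- half-degree even: it is `≥ 4` since `[K:ℚ] ≥ 6` and `[K:ℚ]/2` is even
    have h8 : 8 ≤ Module.finrank ℚ (K : Type) := by
      obtain ⟨A, _, _, θ, -, -, hcard⟩ := exists_galTDatum_of_imaginary_quadratic_subfield hcomm σ₀ E hE hx
      obtain ⟨k, hk⟩ := hpar
      omega
    obtain ⟨⟨𝒮, hcard, hgen⟩, -⟩ := isLeast_card_faces_hgen_of_imaginary_quadratic_subfield_even hcomm σ₀ E hE hx hpar h8
    refine ⟨𝒮, by rw [if_pos hpar, hcard], fun h P B hP hB => ?_⟩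
    exact hodgeConjectureFor_of_avDominatedBy_isProductOf_of_exists_facePeriod_on K h6 (𝒮 : Set (Face K)) σ₀ hgen
      (fun f hf => h f (Finset.mem_coe.mp hf)) hP hB
  · have hodd : Odd (Module.finrank ℚ (K : Type) / 2) := Nat.not_even_iff_odd.mp hpar
    obtain ⟨⟨𝒮, hcard, hgen⟩, -⟩ := isLeast_card_faces_hgen_of_imaginary_quadratic_subfield_odd hcomm σ₀ E hE hx hodd h6
    refine ⟨𝒮, by rw [if_neg hpar, hcard], fun h P B hP hB => ?_⟩
    exact hodgeConjectureFor_of_avDominatedBy_isProductOf_of_exists_facePeriod_on K h6 (𝒮 : Set (Face K)) σ₀ hgen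
      (fun f hf => h f (Finset.mem_coe.mp hf)) hP hB

end Summit.HodgeConjecture.CorCM.FaceAbelian

end
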